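import Summits.CriticalPhenomena.PercolationContinuityZ3.Theorems.Transplant.Slab111HubXAcc
import Summits.CriticalPhenomena.PercolationContinuityZ3.Theorems.Transplant.Slab111HubXBuild
import Summits.CriticalPhenomena.PercolationContinuityZ3.Theorems.Transplant.Slab111HubEntry2
import HarnessLib

/-!
# The HUB ROUTING of the `(111)`-films, XXIX-X: the swap pair of an ACCEPTED zone-free entry (`EntryX.swap_of_acc`)

builds on p205010 (kernel theorem, internal audit signed; external expert review pending) — NOT used in this file.  Lane `prim-bschramm`, seat
`prim-bschramm-p2` (gen 37; class C1b; memo `HOME/bschramm/P2-LATTICES.md` §135); helper file (`--supports stmt-CriticalPhenomena-4575 --as helper`).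
**`EntryX.swap_of_acc`**: at a block of a valid shape («Slab111HubShape».`ShapeB.Valid`, cleared set `WOf S k z`), a certified terminal triple
whose level pattern («Slab111HubXLang».`patOf`) is ACCEPTED by an entry («Slab111HubXAcc».`EntryX.acc` at the terminal columns) has a swap pair:
the static checks and the sound level formulas give a zone-free hub plan («Slab111HubXPlan».`HubPlanX`), whence «Slab111HubXBuild».`HubPlanX.swap`.
[cite: DuminilCopinSidoraviciusTassion2016, §2.3 (proof of Fact 2: the three disjoint paths γ_u, γ_v, γ_w in B_R(z))]
-/

noncomputable section

namespace Summit.CriticalPhenomena.PercolationContinuityZ3.Theorems.Transplant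

open Literature.Probability.Percolation Literature.Probability.LatticeModels SimpleGraph
open scoped Classical

namespace Slab111

variable {k : ℕ}

/-- The static checks, unpacked. [folklore] -/
theorem EntryX.static_unpack {S : ShapeB} {e : EntryX} {q₁ q₂ q₃ : ℤ × ℤ} (h : e.staticB S q₁ q₂ q₃ = true) :
    e.F1.ok ∧ e.F2.ok ∧ e.F3.ok ∧ e.F1.OffHub ∧ e.F2.OffHub ∧ e.F3.OffHub ∧ e.F1.Disj e.F2 ∧ e.F1.Disj e.F3 ∧ e.F2.Disj e.F3 ∧
    Att e.F1 e.d₁ ∧ Att e.F2 e.d₂ ∧ Att e.F3 e.d₃ ∧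
    (S.pcB e.F1.f0 = true ∧ S.pcB e.F1.f1 = true ∧ S.pcB e.F1.f2 = true) ∧ (S.pcB e.F2.f0 = true ∧ S.pcB e.F2.f1 = true ∧ S.pcB e.F2.f2 = true) ∧
    (S.colsB e.F3.f0 = true ∧ S.colsB e.F3.f1 = true ∧ S.colsB e.F3.f2 = true) ∧ S.pcB (0, 0) = true ∧
    (e.τ = 1 ∨ e.τ = -1) ∧ (3 : ℤ) ∣ e.a + (q₁.1 + 2 * q₁.2) ∧ LegOK e.l₁ ∧ LegOK e.l₂ ∧ LegOK e.l₃ ∧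
    e.F1.mem (q₁ + (lastD e.l₁).1) ∧ e.F2.mem (q₂ + (lastD e.l₂).1) ∧ e.F3.mem (q₃ + (lastD e.l₃).1) ∧
    (∀ p ∈ e.l₁.dropLast, ¬ e.F1.mem (q₁ + p.1)) ∧ (∀ p ∈ e.l₂.dropLast, ¬ e.F2.mem (q₂ + p.1)) ∧ (∀ p ∈ e.l₃.dropLast, ¬ e.F3.mem (q₃ + p.1)) ∧
    (∀ p ∈ e.l₁.tail, S.pcB (q₁ + p.1) = true) ∧ (∀ p ∈ e.l₂.tail, S.pcB (q₂ + p.1) = true) ∧ (∀ p ∈ e.l₃.tail, S.colsB (q₃ + p.1) = true) ∧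
    0 ≤ e.τ * (e.a + e.d₁ - (lastD e.l₁).2) := by
  unfold EntryX.staticB at h
  simp only [Bool.and_eq_true, Bool.or_eq_true, beq_iff_eq, decide_eq_true_eq, List.all_eq_true, Bool.not_eq_true', and_assoc] at h
  obtain ⟨hF1, hF2, hF3, ho1, ho2, ho3, h12, h13, h23, hA1, hA2, hA3, p10, p11, p12, p20, p21, p22, w30, w31, w32, hhub, hτ, hmod,
    hl1, hl2, hl3, he1, he2, he3, hd1, hd2, hd3, ht1, ht2, ht3, hside⟩ := h
  refine ⟨faceOk_of_B hF1, faceOk_of_B hF2, faceOk_of_B hF3, offHub_of_B ho1, offHub_of_B ho2, offHub_of_B ho3, disj_of_B h12,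
    disj_of_B h13, disj_of_B h23, att_of_B hA1, att_of_B hA2, att_of_B hA3, ⟨p10, p11, p12⟩, ⟨p20, p21, p22⟩, ⟨w30, w31, w32⟩, hhub, hτ,
    Int.dvd_of_emod_eq_zero hmod, legOK_of_B hl1, legOK_of_B hl2, legOK_of_B hl3, (faceMemB_iff _ _).1 he1, (faceMemB_iff _ _).1 he2,
    (faceMemB_iff _ _).1 he3, fun p hp => ?_, fun p hp => ?_, fun p hp => ?_, ht1, ht2, ht3, hside⟩
  · have := hd1 p hp; rwa [← Bool.not_eq_true, faceMemB_iff] at this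
  · have := hd2 p hp; rwa [← Bool.not_eq_true, faceMemB_iff] at this
  · have := hd3 p hp; rwa [← Bool.not_eq_true, faceMemB_iff] at this

/-- The attachment column is the face column at the attachment level. [folklore] -/
theorem EntryX.colAt_att {c0 : ℤ} (F : FaceD) {d L : ℤ} (hd : d = 1 ∨ d = -1) (hL : (3 : ℤ) ∣ L - c0) :
    colAt F (L + d - c0) = EntryX.attCol F d := by
  unfold EntryX.attCol
  rcases hd with rfl | rfl
  · rw [if_pos rfl]; exact colAt_hub_succ F hL
  · rw [if_neg (by norm_num), show L + -1 - c0 = L - 1 - c0 by ring]; exact colAt_hub_pred F hL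

set_option maxHeartbeats 4000000 in
/-- **THE SWAP PAIR OF AN ACCEPTED ENTRY** at a block of a valid shape. [cite: DuminilCopinSidoraviciusTassion2016, §2.3 (proof of Fact 2: γ_u, γ_v, γ_w)] -/
theorem EntryX.swap_of_acc {S : ShapeB} {tR tD sR sD : ℕ} (hV : S.Valid tR tD sR sD) (e : EntryX) (z : Site 2) {E₁ E₂ w' : slab111 k}
    (hT : (hexShadow k).Terminals 3 z tR tD sR (WOf S k z) E₁ E₂ w')
    (hacc : e.acc S (relC z E₁) (relC z E₂) (relC z w') (patOf (lev (E₁ : Site 3)) (lev (E₂ : Site 3)) (lev (w' : Site 3)) k) = true) :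
    ∃ r₁ r₂ : VRouteData (film k) (WOf S k z ∩ (hexShadow k).lift (blkR 3 z tR sR)) (WOf S k z) E₁ E₂ w', r₁.y = r₂.b ∧ r₁.b = r₂.y := by
  unfold EntryX.acc at hacc
  rw [Bool.and_eq_true] at hacc
  obtain ⟨hst, hfm⟩ := hacc
  obtain ⟨hF1, hF2, hF3, ho1, ho2, ho3, h12, h13, h23, hA1, hA2, hA3, hF1P, hF2P, hF3W, hhub, hτ, hmod, hl1, hl2, hl3, he1, he2, he3,
    hd1, hd2, hd3, ht1, ht2, ht3, hside⟩ := EntryX.static_unpack hst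
  -- notation
  set n₁ := lev (E₁ : Site 3) with hn₁
  set n₂ := lev (E₂ : Site 3) with hn₂
  set n₃ := lev (w' : Site 3) with hn₃
  set q₁ := relC z E₁ with hq₁
  set q₂ := relC z E₂ with hq₂
  set q₃ := relC z w' with hq₃
  have hz : (3 : ℤ) ∣ z 0 + 2 * z 1 - (z 0 + 2 * z 1) := dvd_cls_self z
  obtain ⟨hc1, hs1, h01, hk1⟩ := member_factsG hT.E₁W
  obtain ⟨hc2, hs2, h02, hk2⟩ := member_factsG hT.E₂W
  obtain ⟨hc3, hs3, h03, hk3⟩ := member_factsG hT.w'W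
  have b1 : 0 ≤ n₁ ∧ n₁ ≤ k := ⟨h01, hk1⟩
  have b2 : 0 ≤ n₂ ∧ n₂ ≤ k := ⟨h02, hk2⟩
  have b3 : 0 ≤ n₃ ∧ n₃ ≤ k := ⟨h03, hk3⟩
  have hR1 : inBlkB tR sR q₁ = true := by have := hT.E₁R; rw [hexShadow_sh, sh_mem_blkR_iff] at this; exact this
  have hR2 : inBlkB tR sR q₂ = true := by have := hT.E₂R; rw [hexShadow_sh, sh_mem_blkR_iff] at this; exact this
  have hE1 : sh E₁ = vcol z q₁ ∧ lev (E₁ : Site 3) = n₁ := ⟨hs1, rfl⟩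
  have hE2 : sh E₂ = vcol z q₂ ∧ lev (E₂ : Site 3) = n₂ := ⟨hs2, rfl⟩
  have hE3 : sh w' = vcol z q₃ ∧ lev (w' : Site 3) = n₃ := ⟨hs3, rfl⟩
  have hcl1 := cls_of_sh_lev hz hE1
  have hcl2 := cls_of_sh_lev hz hE2
  have hcl3 := cls_of_sh_lev hz hE3
  -- the parts of the level formula
  unfold EntryX.fm at hfm
  simp only [EntryX.eval_append, Bool.and_eq_true, and_assoc] at hfm
  obtain ⟨hhubQ, hatt, hm1, hm2, hm3, s12', s13', s21', s23', s31', s32', hh1', hh2', hh3', d12', d13', d23'⟩ := hfm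
  have hhubQ' : evalQ (patOf n₁ n₂ n₃ k) e.hubQ = true := EntryX.evalQ_of_mem hhubQ (by simp)
  obtain ⟨hLA1, hLAk, hLD1, hLDk⟩ := EntryX.hubQ_sound b1 b2 b3 hhubQ'
  obtain ⟨aD1, aA2, aD2, aA3, aD3⟩ := EntryX.attFm_sound b1 b2 b3 hatt
  have m1 := EntryX.memFmLeg_sound b1 b2 b3 (i := 1) (Or.inl rfl) hm1
  have m2 := EntryX.memFmLeg_sound b1 b2 b3 (i := 2) (Or.inr (Or.inl rfl)) hm2
  have m3 := EntryX.memFmLeg_sound b1 b2 b3 (i := 3) (Or.inr (Or.inr rfl)) hm3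
  have s12 := EntryX.sepFmLeg_sound b1 b2 b3 (i := 1) (j := 2) (Or.inl rfl) s12'
  have s13 := EntryX.sepFmLeg_sound b1 b2 b3 (i := 1) (j := 3) (Or.inl rfl) s13'
  have s21 := EntryX.sepFmLeg_sound b1 b2 b3 (i := 2) (j := 1) (Or.inr (Or.inl rfl)) s21'
  have s23 := EntryX.sepFmLeg_sound b1 b2 b3 (i := 2) (j := 3) (Or.inr (Or.inl rfl)) s23'
  have s31 := EntryX.sepFmLeg_sound b1 b2 b3 (i := 3) (j := 1) (Or.inr (Or.inr rfl)) s31'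
  have s32 := EntryX.sepFmLeg_sound b1 b2 b3 (i := 3) (j := 2) (Or.inr (Or.inr rfl)) s32'
  have hh1 := EntryX.hubAvoidFmLeg_sound b1 b2 b3 (i := 1) (Or.inl rfl) hh1'
  have hh2 := EntryX.hubAvoidFmLeg_sound b1 b2 b3 (i := 2) (Or.inr (Or.inl rfl)) hh2'
  have hh3 := EntryX.hubAvoidFmLeg_sound b1 b2 b3 (i := 3) (Or.inr (Or.inr rfl)) hh3'
  have d12 := EntryX.distFmLegs_sound b1 b2 b3 (i := 1) (j := 2) (Or.inl rfl) (Or.inr (Or.inl rfl)) d12'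
  have d13 := EntryX.distFmLegs_sound b1 b2 b3 (i := 1) (j := 3) (Or.inl rfl) (Or.inr (Or.inr rfl)) d13'
  have d23 := EntryX.distFmLegs_sound b1 b2 b3 (i := 2) (j := 3) (Or.inr (Or.inl rfl)) (Or.inr (Or.inr rfl)) d23'
  -- values of level terms
  have v1 : ∀ u : ℤ, LvT.val n₁ n₂ n₃ (1, u) = n₁ + u := fun u => by unfold LvT.val; simp
  have v2 : ∀ u : ℤ, LvT.val n₁ n₂ n₃ (2, u) = n₂ + u := fun u => by unfold LvT.val; simp
  have v3 : ∀ u : ℤ, LvT.val n₁ n₂ n₃ (3, u) = n₃ + u := fun u => by unfold LvT.val; simp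
  -- membership helpers
  have memW : ∀ {q : ℤ × ℤ} {L : ℤ}, S.colsB q = true → EntryX.MemFacts S k q L → (3 : ℤ) ∣ L - (z 0 + 2 * z 1) - (q.1 + 2 * q.2) →
      vl k (vcol z q) L ∈ WOf S k z := fun hq hM hd => vl_mem_WOf_any hz hq hM.1 hM.2.1 hM.2.2.1 hM.2.2.2 hd
  have memPR : ∀ {q : ℤ × ℤ} {L : ℤ}, S.pcB q = true → EntryX.MemFacts S k q L → (3 : ℤ) ∣ L - (z 0 + 2 * z 1) - (q.1 + 2 * q.2) →
      vl k (vcol z q) L ∈ WOf S k z ∩ (hexShadow k).lift (blkR 3 z tR sR) := by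
    intro q L hq hM hd
    obtain ⟨hcq, hRq⟩ := (hV.pcR _).1 hq
    refine ⟨memW hcq hM hd, ?_⟩
    rw [HexShadow.mem_lift, hexShadow_sh, sh_mem_blkR_iff, relC_vl (adm_vcol hz hM.1 hM.2.1 hd)]; exact hRq
  -- the legs: heads, last elements
  have hlast1 : lastD e.l₁ = e.l₁.getLast hl1.1 := lastD_eq hl1.1
  have hlast2 : lastD e.l₂ = e.l₂.getLast hl2.1 := lastD_eq hl2.1
  have hlast3 : lastD e.l₃ = e.l₃.getLast hl3.1 := lastD_eq hl3.1
  -- class of leg vertices: RAdm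
  have radm : ∀ {q : ℤ × ℤ} {n : ℤ} {l : List MV}, LegOK l → (3 : ℤ) ∣ n - (z 0 + 2 * z 1) - (q.1 + 2 * q.2) →
      ∀ p ∈ l, (3 : ℤ) ∣ n + p.2 - (z 0 + 2 * z 1) - ((q + p.1).1 + 2 * (q + p.1).2) := by
    intro q n l hl hq p hp
    have hr := hl.2.2.2.2 p hp
    unfold RAdm at hr
    have e' : n + p.2 - (z 0 + 2 * z 1) - ((q + p.1).1 + 2 * (q + p.1).2) = (n - (z 0 + 2 * z 1) - (q.1 + 2 * q.2)) + (p.2 - (p.1.1 + 2 * p.1.2)) := by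
      simp only [Prod.fst_add, Prod.snd_add]; ring
    rw [e']; exact dvd_add hq hr
  -- hub class
  have hLA : (3 : ℤ) ∣ n₁ + e.a - (z 0 + 2 * z 1) := by
    have e' : n₁ + e.a - (z 0 + 2 * z 1) = (n₁ - (z 0 + 2 * z 1) - (q₁.1 + 2 * q₁.2)) + (e.a + (q₁.1 + 2 * q₁.2)) := by ring
    rw [e']; exact dvd_add hcl1 hmod
  have hLD : (3 : ℤ) ∣ n₁ + e.a + 3 * e.τ - (z 0 + 2 * z 1) := by
    have e' : n₁ + e.a + 3 * e.τ - (z 0 + 2 * z 1) = (n₁ + e.a - (z 0 + 2 * z 1)) + 3 * e.τ := by ring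
    rw [e']; exact dvd_add hLA (dvd_mul_right 3 _)
  have hd₁ := hA1.dir_eq; have hd₂ := hA2.dir_eq; have hd₃ := hA3.dir_eq
  -- attachment memberships
  have att_mem : ∀ (F : FaceD) (d L : ℤ) (reg : ℤ × ℤ → Bool), F.ok → (d = 1 ∨ d = -1) → (3 : ℤ) ∣ L - (z 0 + 2 * z 1) →
      EntryX.MemFacts S k (EntryX.attCol F d) (L + d) →
      (∀ {q : ℤ × ℤ} {L' : ℤ}, reg q = true → EntryX.MemFacts S k q L' → (3 : ℤ) ∣ L' - (z 0 + 2 * z 1) - (q.1 + 2 * q.2) → vl k (vcol z q) L' ∈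
        (if reg = S.pcB then WOf S k z ∩ (hexShadow k).lift (blkR 3 z tR sR) else WOf S k z)) →
      reg (EntryX.attCol F d) = true →
      rideV k z (z 0 + 2 * z 1) F (L + d) ∈ (if reg = S.pcB then WOf S k z ∩ (hexShadow k).lift (blkR 3 z tR sR) else WOf S k z) := by
    intro F d L reg hF hd hL hM hmem hreg
    unfold rideV
    rw [EntryX.colAt_att F hd hL]
    refine hmem hreg hM ?_
    have hdc := dvd_colAt hF (L + d - (z 0 + 2 * z 1))
    rw [EntryX.colAt_att F hd hL] at hdc
    have e' : L + d - (z 0 + 2 * z 1) - ((EntryX.attCol F d).1 + 2 * (EntryX.attCol F d).2) =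
        -(((EntryX.attCol F d).1 + 2 * (EntryX.attCol F d).2) - (L + d - (z 0 + 2 * z 1))) := by ring
    rw [e']; exact dvd_neg.2 hdc
  have hmin : min (n₁ + e.a) (n₁ + e.a + 3 * e.τ) = n₁ + min e.a (e.a + 3 * e.τ) := by rw [add_assoc, min_add_add_left]
  have hmax : max (n₁ + e.a) (n₁ + e.a + 3 * e.τ) = n₁ + max e.a (e.a + 3 * e.τ) := by rw [add_assoc, max_add_add_left]
  have P : HubPlanX k z (z 0 + 2 * z 1) (WOf S k z) (WOf S k z ∩ (hexShadow k).lift (blkR 3 z tR sR)) E₁ E₂ w' :=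
  { Pc := S.cols.filter fun c => S.pcB c
    Wc := S.cols.filter fun c => S.colsB c
    q₁ := q₁, q₂ := q₂, q₃ := q₃, n₁ := n₁, n₂ := n₂, n₃ := n₃
    F1 := e.F1, F2 := e.F2, F3 := e.F3, d₁ := e.d₁, d₂ := e.d₂, d₃ := e.d₃
    l₁ := e.l₁, l₂ := e.l₂, l₃ := e.l₃
    LA := n₁ + e.a, LD := n₁ + e.a + 3 * e.τ, τ := e.τ
    hz := hz
    hPRW := Set.inter_subset_left
    hPc := fun q hq L hL1 hLk hd => memPR (List.mem_filter.1 hq).2 ⟨by omega, by omega, fun h => by omega, fun h => by omega⟩ hd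
    hWc := fun q hq L hL1 hLk hd => memW (List.mem_filter.1 hq).2 ⟨by omega, by omega, fun h => by omega, fun h => by omega⟩ hd
    hE1 := hE1, hE2 := hE2, hE3 := hE3
    hE1P := mem_PR_of hT.E₁W hR1
    hE2P := mem_PR_of hT.E₂W hR2
    hE3W := hT.w'W
    hne := hT.ne
    hF1 := hF1, hF2 := hF2, hF3 := hF3, ho1 := ho1, ho2 := ho2, ho3 := ho3, h12 := h12, h13 := h13, h23 := h23
    hA1 := hA1, hA2 := hA2, hA3 := hA3
    hF1P := ⟨List.mem_filter.2 ⟨hV.colsList _ ((hV.pcR _).1 hF1P.1).1, hF1P.1⟩, List.mem_filter.2 ⟨hV.colsList _ ((hV.pcR _).1 hF1P.2.1).1, hF1P.2.1⟩,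
      List.mem_filter.2 ⟨hV.colsList _ ((hV.pcR _).1 hF1P.2.2).1, hF1P.2.2⟩⟩
    hF2P := ⟨List.mem_filter.2 ⟨hV.colsList _ ((hV.pcR _).1 hF2P.1).1, hF2P.1⟩, List.mem_filter.2 ⟨hV.colsList _ ((hV.pcR _).1 hF2P.2.1).1, hF2P.2.1⟩,
      List.mem_filter.2 ⟨hV.colsList _ ((hV.pcR _).1 hF2P.2.2).1, hF2P.2.2⟩⟩
    hF3W := ⟨List.mem_filter.2 ⟨hV.colsList _ hF3W.1, hF3W.1⟩, List.mem_filter.2 ⟨hV.colsList _ hF3W.2.1, hF3W.2.1⟩,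
      List.mem_filter.2 ⟨hV.colsList _ hF3W.2.2, hF3W.2.2⟩⟩
    hub_mem := List.mem_filter.2 ⟨hV.colsList _ ((hV.pcR _).1 hhub).1, hhub⟩
    hl1 := hl1, hl2 := hl2, hl3 := hl3
    he1 := by rw [← hlast1]; exact he1
    he2 := by rw [← hlast2]; exact he2
    he3 := by rw [← hlast3]; exact he3
    ho1' := fun p hp hne => hd1 p (mem_dropLast_of_ne hl1.1 hp hne)
    ho2' := fun p hp hne => hd2 p (mem_dropLast_of_ne hl2.1 hp hne)
    ho3' := fun p hp hne => hd3 p (mem_dropLast_of_ne hl3.1 hp hne)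
    hc1 := by
      intro p hp hp0
      have hpt := mem_tail_of_ne hl1.2.1 hp hp0
      have hM := m1 p hpt; rw [v1] at hM
      refine ⟨⟨hM.1, hM.2.1⟩, ?_⟩
      rw [absV_eq_vl hz hcl1 (hl1.2.2.2.2 p hp) hM.1 hM.2.1]
      exact memPR (ht1 p hpt) hM (radm hl1 hcl1 p hp)
    hc2 := by
      intro p hp hp0
      have hpt := mem_tail_of_ne hl2.2.1 hp hp0
      have hM := m2 p hpt; rw [v2] at hM
      refine ⟨⟨hM.1, hM.2.1⟩, ?_⟩
      rw [absV_eq_vl hz hcl2 (hl2.2.2.2.2 p hp) hM.1 hM.2.1]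
      exact memPR (ht2 p hpt) hM (radm hl2 hcl2 p hp)
    hc3 := by
      intro p hp hp0
      have hpt := mem_tail_of_ne hl3.2.1 hp hp0
      have hM := m3 p hpt; rw [v3] at hM
      refine ⟨⟨hM.1, hM.2.1⟩, ?_⟩
      rw [absV_eq_vl hz hcl3 (hl3.2.2.2.2 p hp) hM.1 hM.2.1]
      exact memW (ht3 p hpt) hM (radm hl3 hcl3 p hp)
    hn1 := b1, hn2 := b2, hn3 := b3
    hτ := hτ
    hLD := rfl
    hLA := hLA
    hLA1 := hLA1
    hLAk := hLAk
    hLD1 := hLD1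
    hLDk := hLDk
    hatD1 := by
      have := att_mem e.F1 e.d₁ (n₁ + e.a + 3 * e.τ) S.pcB hF1 hd₁ hLD aD1 (fun hq hM hd => by rw [if_pos rfl]; exact memPR hq hM hd)
        (by unfold EntryX.attCol; rcases hd₁ with h | h <;> simp [h, hF1P.2.1, hF1P.2.2])
      rwa [if_pos rfl] at this
    hatA2 := by
      have := att_mem e.F2 e.d₂ (n₁ + e.a) S.pcB hF2 hd₂ hLA aA2 (fun hq hM hd => by rw [if_pos rfl]; exact memPR hq hM hd)
        (by unfold EntryX.attCol; rcases hd₂ with h | h <;> simp [h, hF2P.2.1, hF2P.2.2])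
      rwa [if_pos rfl] at this
    hatD2 := by
      have := att_mem e.F2 e.d₂ (n₁ + e.a + 3 * e.τ) S.pcB hF2 hd₂ hLD aD2 (fun hq hM hd => by rw [if_pos rfl]; exact memPR hq hM hd)
        (by unfold EntryX.attCol; rcases hd₂ with h | h <;> simp [h, hF2P.2.1, hF2P.2.2])
      rwa [if_pos rfl] at this
    hatA3 := by
      have key : ∀ {q : ℤ × ℤ} {L' : ℤ}, S.colsB q = true → EntryX.MemFacts S k q L' → (3 : ℤ) ∣ L' - (z 0 + 2 * z 1) - (q.1 + 2 * q.2) →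
          vl k (vcol z q) L' ∈ WOf S k z := fun hq hM hd => memW hq hM hd
      unfold rideV
      rw [EntryX.colAt_att e.F3 hd₃ hLA]
      refine key (by unfold EntryX.attCol; rcases hd₃ with h | h <;> simp [h, hF3W.2.1, hF3W.2.2]) aA3 ?_
      have hdc := dvd_colAt hF3 (n₁ + e.a + e.d₃ - (z 0 + 2 * z 1))
      rw [EntryX.colAt_att e.F3 hd₃ hLA] at hdc
      have e' : n₁ + e.a + e.d₃ - (z 0 + 2 * z 1) - ((EntryX.attCol e.F3 e.d₃).1 + 2 * (EntryX.attCol e.F3 e.d₃).2) =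
          -(((EntryX.attCol e.F3 e.d₃).1 + 2 * (EntryX.attCol e.F3 e.d₃).2) - (n₁ + e.a + e.d₃ - (z 0 + 2 * z 1))) := by ring
      rw [e']; exact dvd_neg.2 hdc
    hatD3 := by
      have key : ∀ {q : ℤ × ℤ} {L' : ℤ}, S.colsB q = true → EntryX.MemFacts S k q L' → (3 : ℤ) ∣ L' - (z 0 + 2 * z 1) - (q.1 + 2 * q.2) →
          vl k (vcol z q) L' ∈ WOf S k z := fun hq hM hd => memW hq hM hd
      unfold rideV
      rw [EntryX.colAt_att e.F3 hd₃ hLD]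
      refine key (by unfold EntryX.attCol; rcases hd₃ with h | h <;> simp [h, hF3W.2.1, hF3W.2.2]) aD3 ?_
      have hdc := dvd_colAt hF3 (n₁ + e.a + 3 * e.τ + e.d₃ - (z 0 + 2 * z 1))
      rw [EntryX.colAt_att e.F3 hd₃ hLD] at hdc
      have e' : n₁ + e.a + 3 * e.τ + e.d₃ - (z 0 + 2 * z 1) - ((EntryX.attCol e.F3 e.d₃).1 + 2 * (EntryX.attCol e.F3 e.d₃).2) =
          -(((EntryX.attCol e.F3 e.d₃).1 + 2 * (EntryX.attCol e.F3 e.d₃).2) - (n₁ + e.a + 3 * e.τ + e.d₃ - (z 0 + 2 * z 1))) := by ring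
      rw [e']; exact dvd_neg.2 hdc
    hside := by
      rw [← hlast1, show n₁ + e.a + e.d₁ - (n₁ + (lastD e.l₁).2) = e.a + e.d₁ - (lastD e.l₁).2 by ring]; exact hside
    s21 := by
      intro p hp hne
      by_cases hm : e.F2.mem (q₁ + p.1)
      · right
        rcases s12 p (mem_dropLast_of_ne hl1.1 hp hne) (by unfold EntryX.face; simpa using hm) with hlo | hhi
        · left
          have a1 := hlo (2, (lastD e.l₂).2) (by unfold EntryX.winLo; simp)
          have a2 := hlo (1, min e.a (e.a + 3 * e.τ) + e.d₂) (by unfold EntryX.winLo; simp)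
          rw [v1, v2, hlast2] at a1; rw [v1, v1] at a2
          rw [hmin, lt_min_iff]; exact ⟨a1, by omega⟩
        · right
          have a1 := hhi (2, (lastD e.l₂).2) (by unfold EntryX.winHi; simp)
          have a2 := hhi (1, max e.a (e.a + 3 * e.τ) + e.d₂) (by unfold EntryX.winHi; simp)
          rw [v1, v2, hlast2] at a1; rw [v1, v1] at a2
          rw [hmax, max_lt_iff]; exact ⟨a1, by omega⟩
      · exact Or.inl hm
    s31 := by
      intro p hp hne
      by_cases hm : e.F3.mem (q₁ + p.1)
      · right
        rcases s13 p (mem_dropLast_of_ne hl1.1 hp hne) (by unfold EntryX.face; simpa using hm) with hlo | hhi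
        · left
          have a1 := hlo (3, (lastD e.l₃).2) (by unfold EntryX.winLo; simp)
          have a2 := hlo (1, min e.a (e.a + 3 * e.τ) + e.d₃) (by unfold EntryX.winLo; simp)
          rw [v1, v3, hlast3] at a1; rw [v1, v1] at a2
          rw [hmin, lt_min_iff]; exact ⟨a1, by omega⟩
        · right
          have a1 := hhi (3, (lastD e.l₃).2) (by unfold EntryX.winHi; simp)
          have a2 := hhi (1, max e.a (e.a + 3 * e.τ) + e.d₃) (by unfold EntryX.winHi; simp)
          rw [v1, v3, hlast3] at a1; rw [v1, v1] at a2
          rw [hmax, max_lt_iff]; exact ⟨a1, by omega⟩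
      · exact Or.inl hm
    s12 := by
      intro p hp hne
      by_cases hm : e.F1.mem (q₂ + p.1)
      · right
        rcases s21 p (mem_dropLast_of_ne hl2.1 hp hne) (by unfold EntryX.face; simpa using hm) with hlo | hhi
        · left
          have a1 := hlo (1, (lastD e.l₁).2) (by unfold EntryX.winLo; simp)
          have a2 := hlo (1, e.a + 3 * e.τ + e.d₁) (by unfold EntryX.winLo; simp)
          rw [v2, v1, hlast1] at a1; rw [v2, v1] at a2
          rw [lt_min_iff]; exact ⟨a1, by omega⟩
        · right
          have a1 := hhi (1, (lastD e.l₁).2) (by unfold EntryX.winHi; simp)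
          have a2 := hhi (1, e.a + 3 * e.τ + e.d₁) (by unfold EntryX.winHi; simp)
          rw [v2, v1, hlast1] at a1; rw [v2, v1] at a2
          rw [max_lt_iff]; exact ⟨a1, by omega⟩
      · exact Or.inl hm
    s32 := by
      intro p hp hne
      by_cases hm : e.F3.mem (q₂ + p.1)
      · right
        rcases s23 p (mem_dropLast_of_ne hl2.1 hp hne) (by unfold EntryX.face; simpa using hm) with hlo | hhi
        · left
          have a1 := hlo (3, (lastD e.l₃).2) (by unfold EntryX.winLo; simp)
          have a2 := hlo (1, min e.a (e.a + 3 * e.τ) + e.d₃) (by unfold EntryX.winLo; simp)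
          rw [v2, v3, hlast3] at a1; rw [v2, v1] at a2
          rw [hmin, lt_min_iff]; exact ⟨a1, by omega⟩
        · right
          have a1 := hhi (3, (lastD e.l₃).2) (by unfold EntryX.winHi; simp)
          have a2 := hhi (1, max e.a (e.a + 3 * e.τ) + e.d₃) (by unfold EntryX.winHi; simp)
          rw [v2, v3, hlast3] at a1; rw [v2, v1] at a2
          rw [hmax, max_lt_iff]; exact ⟨a1, by omega⟩
      · exact Or.inl hm
    s13 := by
      intro p hp hne
      by_cases hm : e.F1.mem (q₃ + p.1)
      · right
        rcases s31 p (mem_dropLast_of_ne hl3.1 hp hne) (by unfold EntryX.face; simpa using hm) with hlo | hhi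
        · left
          have a1 := hlo (1, (lastD e.l₁).2) (by unfold EntryX.winLo; simp)
          have a2 := hlo (1, e.a + 3 * e.τ + e.d₁) (by unfold EntryX.winLo; simp)
          rw [v3, v1, hlast1] at a1; rw [v3, v1] at a2
          rw [lt_min_iff]; exact ⟨a1, by omega⟩
        · right
          have a1 := hhi (1, (lastD e.l₁).2) (by unfold EntryX.winHi; simp)
          have a2 := hhi (1, e.a + 3 * e.τ + e.d₁) (by unfold EntryX.winHi; simp)
          rw [v3, v1, hlast1] at a1; rw [v3, v1] at a2
          rw [max_lt_iff]; exact ⟨a1, by omega⟩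
      · exact Or.inl hm
    s23 := by
      intro p hp hne
      by_cases hm : e.F2.mem (q₃ + p.1)
      · right
        rcases s32 p (mem_dropLast_of_ne hl3.1 hp hne) (by unfold EntryX.face; simpa using hm) with hlo | hhi
        · left
          have a1 := hlo (2, (lastD e.l₂).2) (by unfold EntryX.winLo; simp)
          have a2 := hlo (1, min e.a (e.a + 3 * e.τ) + e.d₂) (by unfold EntryX.winLo; simp)
          rw [v3, v2, hlast2] at a1; rw [v3, v1] at a2
          rw [hmin, lt_min_iff]; exact ⟨a1, by omega⟩
        · right
          have a1 := hhi (2, (lastD e.l₂).2) (by unfold EntryX.winHi; simp)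
          have a2 := hhi (1, max e.a (e.a + 3 * e.τ) + e.d₂) (by unfold EntryX.winHi; simp)
          rw [v3, v2, hlast2] at a1; rw [v3, v1] at a2
          rw [hmax, max_lt_iff]; exact ⟨a1, by omega⟩
      · exact Or.inl hm
    hh1 := by
      intro p hp hne
      by_cases hq : q₁ + p.1 = (0, 0)
      · right; have := hh1 p (mem_dropLast_of_ne hl1.1 hp hne) hq; rw [v1] at this; exact this
      · exact Or.inl hq
    hh2 := by
      intro p hp hne
      by_cases hq : q₂ + p.1 = (0, 0)
      · right; have := hh2 p (mem_dropLast_of_ne hl2.1 hp hne) hq; rw [v2] at this; exact this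
      · exact Or.inl hq
    hh3 := by
      intro p hp hne
      by_cases hq : q₃ + p.1 = (0, 0)
      · right; have := hh3 p (mem_dropLast_of_ne hl3.1 hp hne) hq; rw [v3] at this; exact this
      · exact Or.inl hq
    d12 := by
      intro p hp hne p' hp' hne' heq
      simp only [Prod.mk.injEq] at heq
      have := d12 p (mem_dropLast_of_ne hl1.1 hp hne) p' (mem_dropLast_of_ne hl2.1 hp' hne') heq.1
      rw [v1, v2] at this; exact this heq.2
    d13 := by
      intro p hp hne p' hp' hne' heq
      simp only [Prod.mk.injEq] at heq
      have := d13 p (mem_dropLast_of_ne hl1.1 hp hne) p' (mem_dropLast_of_ne hl3.1 hp' hne') heq.1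
      rw [v1, v3] at this; exact this heq.2
    d23 := by
      intro p hp hne p' hp' hne' heq
      simp only [Prod.mk.injEq] at heq
      have := d23 p (mem_dropLast_of_ne hl2.1 hp hne) p' (mem_dropLast_of_ne hl3.1 hp' hne') heq.1
      rw [v2, v3] at this; exact this heq.2 }
  exact P.swap

end Slab111

end Summit.CriticalPhenomena.PercolationContinuityZ3.Theorems.Transplant

end
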